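import Literature.AlgebraicGeometry.Motives.HodgeStructureDirectSum
import Literature.AlgebraicGeometry.Motives.HodgeStructureStrictProofs
import Literature.AlgebraicGeometry.Motives.HodgeStructureProofs
import HarnessLib

/-!
# Lifting morphisms of Hodge structures along morphisms from polarisable Hodge structures

Family `hodge`, ABSTRACT layer `Literature/AlgebraicGeometry/Motives` (rational Hodge structures
`HodgeStructure V n`, morphisms `Hom`, sub-Hodge structures, polarisations). The category of
polarisable rational Hodge structures is semisimple (Deligne, Hodge II, 2.1; Voisin I Lemma 7.26;
Voisin 2025, Prop. 2.11: "the orthogonal of a sub-Hodge structure is a complementary sub-Hodge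
structure", the tree's `SubHodgeStructure.exists_isCompl_eq_orthogonal`), and morphisms of Hodge
structures are strict (Deligne, Hodge II, Thm. 2.3.5 (iii), the tree's `Hom.strict_holds`). The
consequence recorded here is the LIFTING PROPERTY used in Grothendieck's argument that the
generalised Hodge conjecture in level one follows from, and gives back, the algebraicity of
level-one correspondences (Topology 8 (1969), p. 301; Abdulali in Kerr–Pearlstein 2016, Ch. 11):

* `Hom.exists_comp_eq_of_range_le` — **if `G : H₁ → H₂` is a morphism from a finite-dimensional
  polarisable Hodge structure and `φ : H₀ → H₂` is a morphism with `im φ ⊆ im G`, then `φ = G ∘ ψ`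
  for a morphism `ψ : H₀ → H₁`.** Proof: `ker G` underlies a sub-Hodge structure `K`
  (`Hom.exists_subHodgeStructure_ker`) with a complementary sub-Hodge structure `K'`
  (semisimplicity); `G|_{K'}` is injective with the same image, so `ψ₀ := (G|_{K'})⁻¹ ∘ φ` is a
  well-defined `ℚ`-linear map into `K'`, and it respects the Hodge filtrations because `G|_{K'}`
  is strict and injective after complexification (`ℂ` flat over `ℚ`);
* `Hom.exists_section_of_surjective` — a surjective morphism from a finite-dimensional
  polarisable Hodge structure has a section which is a morphism of Hodge structures;
* small API (existence form, no new definitions): `Hom.exists_of_mapPieceLe` (a `ℚ`-linear map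
  respecting the pieces underlies a morphism), `SubHodgeStructure.exists_hom_subtype` (the
  inclusion of a sub-Hodge structure underlies a morphism).

Everything is proved; no definition, no named fact.

## References

* [DeligneHodgeII1971] P. Deligne, Théorie de Hodge II, 1.2.5, 2.1, Thm. 2.3.5 (iii).
* [VoisinHodgeI2002] C. Voisin, Hodge Theory and Complex Algebraic Geometry I, §7.3.1 Lemma 7.26.
* [Voisin2025] C. Voisin, Hodge and generalized Hodge conjectures, coniveau and algebraic cycles,
  Prop. 2.11, Cor. 2.12.
* [KerrPearlstein2016] Kerr–Pearlstein (eds.), Recent Advances in Hodge Theory, Ch. 11 (Abdulali)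
  Prop. 3.2.
-/

noncomputable section

open scoped TensorProduct

namespace Literature.AlgebraicGeometry.Motives

namespace HodgeStructure

universe u v w

variable {V : Type u} [AddCommGroup V] [Module ℚ V]
variable {W : Type v} [AddCommGroup W] [Module ℚ W]
variable {U : Type w} [AddCommGroup U] [Module ℚ U]
variable {n : ℤ}

/-! ### Small API: morphisms from pieces; the inclusion of a sub-Hodge structure -/

/-- **A `ℚ`-linear map whose complexification maps `V^{p,q}` into `W^{p,q}` for all `p + q = n`
underlies a morphism of Hodge structures** (`Fᵖ = ⊕_{i ≥ p} V^{i,n-i}`, `F_eq_iSup_piece_holds`,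
and `W^{i,n-i} ⊆ Fⁱ ⊆ Fᵖ`). [cite: VoisinHodgeI2002, §7.1.1 and §7.3.1 Def. 7.22] -/
theorem Hom.exists_of_mapPieceLe (H₁ : HodgeStructure V n) (H₂ : HodgeStructure W n) (g : V →ₗ[ℚ] W)
    (hg : ∀ p q : ℤ, p + q = n → (H₁.piece p q).map (g.baseChange ℂ) ≤ H₂.piece p q) :
    ∃ f : Hom H₁ H₂, f.toLinearMap = g :=
  ⟨{ toLinearMap := g
     map_F_le := fun p ↦ by
       rw [F_eq_iSup_piece_holds H₁ p, Submodule.map_iSup]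
       refine iSup_le fun i ↦ ?_
       rw [Submodule.map_iSup]
       refine iSup_le fun hi ↦ ?_
       exact (hg i (n - i) (by omega)).trans ((H₂.piece_le_F i (n - i)).trans (H₂.antitone_F hi)) },
    rfl⟩

/-- **The inclusion of a sub-Hodge structure underlies a morphism of Hodge structures** (its
filtration is the pull-back of `F`). [cite: VoisinHodgeI2002, §7.3.1 Def. 7.24] -/
theorem SubHodgeStructure.exists_hom_subtype {H : HodgeStructure V n} (S : SubHodgeStructure H) :
    ∃ ι : Hom S.toHodgeStructure H, ι.toLinearMap = S.toSubmodule.subtype :=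
  ⟨{ toLinearMap := S.toSubmodule.subtype
     map_F_le := fun p ↦ by
       rintro _ ⟨x, hx, rfl⟩
       rw [SetLike.mem_coe, SubHodgeStructure.toHodgeStructure_F, Submodule.mem_comap] at hx
       exact hx },
    rfl⟩

/-- The underlying map of a composite. [folklore] -/
theorem Hom.comp_toLinearMap' {H₁ : HodgeStructure V n} {H₂ : HodgeStructure W n}
    {H₃ : HodgeStructure U n} (g : Hom H₂ H₃) (f : Hom H₁ H₂) :
    (g.comp f).toLinearMap = g.toLinearMap ∘ₗ f.toLinearMap :=
  rfl

/-! ### The lifting property -/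

/-- **Morphisms lift along morphisms from polarisable Hodge structures.** Let `H₁` be a
finite-dimensional polarisable Hodge structure, `G : H₁ → H₂` and `φ : H₀ → H₂` morphisms of Hodge
structures (same weight) with `im φ ⊆ im G` (as `ℚ`-subspaces). Then `φ = G ∘ ψ` for a morphism
`ψ : H₀ → H₁`. Proof: `ker G` underlies a sub-Hodge structure `K` (`Hom.exists_subHodgeStructure_ker`),
which has a complementary sub-Hodge structure `K'` (`SubHodgeStructure.exists_isCompl_eq_orthogonal`,
semisimplicity of polarised Hodge structures); `G' = G|_{K'}` is injective with `im G' = im G`, so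
`ψ₀ = G'⁻¹ ∘ φ : V₀ → K'` is `ℚ`-linear with `G ∘ ι_{K'} ∘ ψ₀ = φ`; for `x ∈ Fᵖ H₀`,
`φ_ℂ x ∈ Fᵖ H₂ ∩ im G'_ℂ = G'_ℂ(Fᵖ K')` by strictness (`Hom.strict_holds`), and `G'_ℂ` is injective
(`ℂ` flat over `ℚ`), so `(ψ₀)_ℂ x ∈ Fᵖ K'`. [cite: DeligneHodgeII1971, 2.1 and Thm. 2.3.5(iii)]
[cite: VoisinHodgeI2002, §7.3.1 Lemma 7.26] [cite: Voisin2025, Prop. 2.11] -/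
theorem Hom.exists_comp_eq_of_range_le [Module.Finite ℚ V] {H₁ : HodgeStructure V n}
    (hH₁ : H₁.IsPolarizable) {H₂ : HodgeStructure W n} {H₀ : HodgeStructure U n} (G : Hom H₁ H₂)
    (φ : Hom H₀ H₂) (hle : LinearMap.range φ.toLinearMap ≤ LinearMap.range G.toLinearMap) :
    ∃ ψ : Hom H₀ H₁, G.comp ψ = φ := by
  classical
  -- the kernel and a complement, both sub-Hodge structures
  obtain ⟨K, hK⟩ := G.exists_subHodgeStructure_ker
  obtain ⟨K', -, hc⟩ := SubHodgeStructure.exists_isCompl_eq_orthogonal hH₁.some K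
  -- `G' = G|_{K'}` is injective with the same image
  obtain ⟨ιK', hιK'⟩ := K'.exists_hom_subtype
  set G' : Hom K'.toHodgeStructure H₂ := G.comp ιK' with hG'def
  have hG'apply : ∀ k : K'.toSubmodule, G'.toLinearMap k = G.toLinearMap (k : V) := fun k ↦ by
    rw [hG'def, Hom.comp_toLinearMap', LinearMap.comp_apply, hιK', Submodule.subtype_apply]
  have hinj : Function.Injective G'.toLinearMap := by
    rw [← LinearMap.ker_eq_bot, Submodule.eq_bot_iff]
    intro k hk
    rw [LinearMap.mem_ker, hG'apply, ← LinearMap.mem_ker, ← hK] at hk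
    have h0 : (k : V) ∈ K.toSubmodule ⊓ K'.toSubmodule := ⟨hk, k.2⟩
    rw [hc.inf_eq_bot, Submodule.mem_bot] at h0
    exact Subtype.ext h0
  have hrange : LinearMap.range G.toLinearMap ≤ LinearMap.range G'.toLinearMap := by
    rintro _ ⟨v, rfl⟩
    -- `v = k + k'` with `k ∈ ker G`, `k' ∈ K'`
    have hv : v ∈ K.toSubmodule ⊔ K'.toSubmodule := by rw [hc.sup_eq_top]; exact Submodule.mem_top
    obtain ⟨k, hk, k', hk', rfl⟩ := Submodule.mem_sup.1 hv
    refine ⟨⟨k', hk'⟩, ?_⟩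
    rw [hG'apply, map_add]
    have hk0 : G.toLinearMap k = 0 := by rw [← LinearMap.mem_ker, ← hK]; exact hk
    rw [hk0, zero_add]
  -- `ψ₀ = G'⁻¹ ∘ φ`
  have hφ : ∀ u, φ.toLinearMap u ∈ LinearMap.range G'.toLinearMap := fun u ↦
    hrange (hle ⟨u, rfl⟩)
  set e := LinearEquiv.ofInjective G'.toLinearMap hinj with hedef
  set ψ₀ : U →ₗ[ℚ] K'.toSubmodule :=
    e.symm.toLinearMap ∘ₗ (φ.toLinearMap.codRestrict (LinearMap.range G'.toLinearMap) hφ) with hψ₀def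
  have hGψ₀ : ∀ u, G'.toLinearMap (ψ₀ u) = φ.toLinearMap u := by
    intro u
    have h := LinearEquiv.ofInjective_apply G'.toLinearMap (h := hinj)
      (e.symm (φ.toLinearMap.codRestrict (LinearMap.range G'.toLinearMap) hφ u))
    rw [← hedef, LinearEquiv.apply_symm_apply] at h
    exact h.symm
  have hcomp : G'.toLinearMap ∘ₗ ψ₀ = φ.toLinearMap := LinearMap.ext fun u ↦ hGψ₀ u
  -- complexified: `G'_ℂ ∘ (ψ₀)_ℂ = φ_ℂ`
  have hGψ₀c : ∀ x, G'.toLinearMap.baseChange ℂ (ψ₀.baseChange ℂ x) = φ.toLinearMap.baseChange ℂ x := by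
    intro x
    rw [← LinearMap.comp_apply (G'.toLinearMap.baseChange ℂ), ← LinearMap.baseChange_comp, hcomp]
  have hinjc : Function.Injective (G'.toLinearMap.baseChange ℂ) := baseChange_injective_of_injective hinj
  -- `ψ₀` respects the filtrations: strictness of `G'`
  let ψ₁ : Hom H₀ K'.toHodgeStructure :=
    { toLinearMap := ψ₀
      map_F_le := fun p ↦ by
        rintro _ ⟨x, hx, rfl⟩
        have hφx : φ.toLinearMap.baseChange ℂ x ∈
            H₂.F p ⊓ LinearMap.range (G'.toLinearMap.baseChange ℂ) :=
          ⟨φ.map_F_le p ⟨x, hx, rfl⟩, ⟨_, hGψ₀c x⟩⟩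
        rw [← Hom.strict_holds G' p] at hφx
        obtain ⟨k, hk, hkx⟩ := hφx
        rw [← hGψ₀c x] at hkx
        rw [← hinjc hkx]
        exact hk }
  refine ⟨ιK'.comp ψ₁, ?_⟩
  -- `G ∘ ι ∘ ψ₀ = φ`
  have h : (G.comp (ιK'.comp ψ₁)).toLinearMap = φ.toLinearMap := hcomp
  cases φ
  simp only [Hom.comp] at h ⊢
  congr

/-- **A surjective morphism from a finite-dimensional polarisable Hodge structure has a section
which is a morphism of Hodge structures** (lift the identity).
[cite: DeligneHodgeII1971, 2.1 and Thm. 2.3.5(iii)] [cite: VoisinHodgeI2002, §7.3.1 Lemma 7.26] -/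
theorem Hom.exists_section_of_surjective [Module.Finite ℚ V] {H₁ : HodgeStructure V n}
    (hH₁ : H₁.IsPolarizable) {H₂ : HodgeStructure W n} (G : Hom H₁ H₂)
    (hG : Function.Surjective G.toLinearMap) :
    ∃ σ : Hom H₂ H₁, G.comp σ = Hom.id H₂ :=
  G.exists_comp_eq_of_range_le hH₁ (Hom.id H₂) (by
    rw [LinearMap.range_eq_top.2 hG]
    exact le_top)

end HodgeStructure

end Literature.AlgebraicGeometry.Motives

end
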